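import Literature.AlgebraicGeometry.HodgeTheory.HodgeLociDichotomyOfHolomorphicFrames
import HarnessLib

/-!
# Hodge loci are cut out by holomorphic equations: the zero-set form of the analytic dichotomy

Family `hodge`, layer `Literature/AlgebraicGeometry/HodgeTheory`; proof file (theorems only, no
definition, no named fact). Written by the prover seat `hodge-nonav-prover-Ax` (g13) of the cell
`hodge-nonav` for route `HodgeConjecture/CyclicUnitaryPowers` (crux K1-A, stmt-HodgeConjecture-19544),
programme «AE» (sharpening the CDK-free analytic «very general» from MEAGRE to «off a countable union
of local analytic hypersurfaces», hence meagre AND Lebesgue-null).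

`HodgeLociDichotomyOfHolomorphicFrames.hodgeLociDichotomy_of_holomorphicFrame` proves, from a
holomorphic frame adapted to the Hodge filtration in a flat trivialisation over a path-connected chart
domain `W`, that the locus of points of `W` at which a rational tensor `ζ` is a weight-`0` Hodge tensor
is ALL of `W` or NOWHERE DENSE. Its proof shows more, and this file records it (Voisin II, Lemma 5.13:
"the sets `U_λ^p` are analytic subsets of `U`"; Cattani–Deligne–Kaplan 1995, §1): the locus is all of
`W`, or it is contained in the zero set `{t ∈ W | g (ψ t) = 0}` of ONE function `g` holomorphic on the
connected chart image `ψ(W)` and not identically zero there (a coordinate of `1 ⊗ ζ` of negative degree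
in the moving tensor basis).

* `isNowhereDense_zeroSet_comp_chart`, `mem_zeroSet_comp_chart_of_mem_closure` — such a zero set is
  nowhere dense and closed in `W` (identity principle; continuity).
* `hodgeLoci_subset_zeroSet_of_holomorphicFrame` — the zero-set form of the dichotomy (same hypotheses
  as `hodgeLociDichotomy_of_holomorphicFrame`).

Downstream (same seat): the Baire bookkeeping with a smallness predicate
(`HodgeGenericPointsOffSmallCover`) turns this into «the non-Hodge-generic points lie in a countable
union of such zero sets», which is meagre (as before) and, read in algebraic charts, Lebesgue-null
(`Analysis/Calculus/RealAnalyticZeroSetAddHaar`), and COUNTABLE over one-dimensional bases.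

## References

* [VoisinHodgeII2003] C. Voisin, Hodge Theory and Complex Algebraic Geometry II, CUP 2003, §5.3.1
  Lemma 5.13 (the Hodge loci `U_λ^p` are analytic subsets).
* [CattaniDeligneKaplan1995JAMS] E. Cattani, P. Deligne, A. Kaplan, On the locus of Hodge classes,
  J. Amer. Math. Soc. 8 (1995), §1.
* [Deligne1972WeilK3] P. Deligne, La conjecture de Weil pour les surfaces K3, Invent. Math. 15
  (1972), Prop. 7.5.
* [DeligneHodgeII1971] P. Deligne, Théorie de Hodge II, Publ. Math. IHÉS 40 (1971), 1.1.12.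
* [FritzscheGrauert2002] K. Fritzsche, H. Grauert, From Holomorphic Functions to Complex Manifolds,
  GTM 213 (2002), Ch. I §8 (analytic sets; Prop. 8.1).
-/

noncomputable section

open CategoryTheory AlgebraicGeometry
open _root_.Topology _root_.Filter
open scoped TensorProduct
open Literature.AlgebraicTopology.SingularHomology
open Literature.AlgebraicGeometry.Motives

namespace Literature.AlgebraicGeometry.HodgeTheory

section HodgeTheory

/-! ### Zero sets of holomorphic functions read through a chart -/

section Topology

variable {X : Type*} [TopologicalSpace X] {d : ℕ}

/-- **The zero set, inside a path-connected `W` lying in the source of a chart `ψ : X → ℂᵈ`, of a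
function holomorphic on `ψ(W)` and not identically zero there is nowhere dense** (identity principle:
a holomorphic function on the connected open `ψ(W)` vanishing on an open subset vanishes identically;
so the zero set, closed in `W`, has empty interior) — Fritzsche–Grauert, Ch. I §8 Prop. 8.1: "Assume
that `A` is an analytic set in a domain `G ⊂ ℂⁿ`. If `A` has an interior point, then `A = G`", read
through the chart. [cite: FritzscheGrauert2002, Chapter I §8 Proposition 8.1] -/
theorem isNowhereDense_zeroSet_comp_chart {W : Set X} (hWo : IsOpen W) (hWpc : IsPathConnected W)
    (ψ : OpenPartialHomeomorph X (Fin d → ℂ)) (hWψ : W ⊆ ψ.source) {g : (Fin d → ℂ) → ℂ}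
    (hg : AnalyticOnNhd ℂ g (ψ '' W)) (hne : ∃ t₁ ∈ W, g (ψ t₁) ≠ 0) :
    IsNowhereDense {t : X | t ∈ W ∧ g (ψ t) = 0} := by
  obtain ⟨t₁, ht₁, hne⟩ := hne
  have hgc : ContinuousOn (fun t ↦ g (ψ t)) W :=
    hg.continuousOn.comp (ψ.continuousOn.mono hWψ) (Set.mapsTo_image ψ W)
  refine isNowhereDense_of_relClosed hWo (fun t ht ↦ ht.1) (fun t ht htc ↦ ⟨ht, ?_⟩) ?_
  · -- closed in `W`
    have htc' : t ∈ closure {y : X | y ∈ W ∧ ∀ i : Unit, (fun (_ : Unit) (t : X) ↦ g (ψ t)) i y = 0} := by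
      refine closure_mono (fun t' ht' ↦ ?_) htc
      exact ⟨ht'.1, fun _ ↦ ht'.2⟩
    exact mem_of_mem_closure_zeroSet hWo (fun (_ : Unit) (t : X) ↦ g (ψ t)) (fun _ ↦ hgc) ht htc' ()
  · -- empty interior, by the identity principle
    rw [Set.eq_empty_iff_forall_notMem]
    intro t₂ ht₂
    rw [mem_interior] at ht₂
    obtain ⟨O, hOZ, hOo, ht₂O⟩ := ht₂
    have hOW : O ⊆ W := fun t ht ↦ (hOZ ht).1
    have hev : g =ᶠ[𝓝 (ψ t₂)] 0 := by
      filter_upwards [ψ.image_mem_nhds (hWψ (hOW ht₂O)) (hOo.mem_nhds ht₂O)] with z hz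
      obtain ⟨t, htO, rfl⟩ := hz
      exact (hOZ htO).2
    have hpre : IsPreconnected (ψ '' W) :=
      (hWpc.image' (ψ.continuousOn.mono hWψ)).isConnected.isPreconnected
    have hzero := hg.eqOn_zero_of_preconnected_of_eventuallyEq_zero hpre ⟨t₂, hOW ht₂O, rfl⟩ hev
      ⟨t₁, ht₁, rfl⟩
    exact hne hzero

/-- The zero set of `g ∘ ψ` in `W` (for `g` holomorphic on `ψ(W)`, `W ⊆ ψ.source` open) is closed in
`W` (Fritzsche–Grauert, Ch. I §8: "an analytic set `A ⊂ G` is always closed in `G`"; here by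
continuity). [cite: FritzscheGrauert2002, Chapter I §8 (analytic sets are closed), before Proposition 8.1] -/
theorem mem_zeroSet_comp_chart_of_mem_closure {W : Set X} (hWo : IsOpen W)
    (ψ : OpenPartialHomeomorph X (Fin d → ℂ)) (hWψ : W ⊆ ψ.source) {g : (Fin d → ℂ) → ℂ}
    (hg : AnalyticOnNhd ℂ g (ψ '' W)) {t : X} (ht : t ∈ W)
    (htc : t ∈ closure {t : X | t ∈ W ∧ g (ψ t) = 0}) : t ∈ {t : X | t ∈ W ∧ g (ψ t) = 0} := by
  have hgc : ContinuousOn (fun t ↦ g (ψ t)) W :=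
    hg.continuousOn.comp (ψ.continuousOn.mono hWψ) (Set.mapsTo_image ψ W)
  have htc' : t ∈ closure {y : X | y ∈ W ∧ ∀ i : Unit, (fun (_ : Unit) (t : X) ↦ g (ψ t)) i y = 0} := by
    refine closure_mono (fun t' ht' ↦ ?_) htc
    exact ⟨ht'.1, fun _ ↦ ht'.2⟩
  exact ⟨ht, mem_of_mem_closure_zeroSet hWo (fun (_ : Unit) (t : X) ↦ g (ψ t)) (fun _ ↦ hgc) ht htc' ()⟩

end Topology

/-! ### The zero-set form of the dichotomy -/

section ZeroSet

variable {𝒳 S : SchemeOver ℂ} (f : 𝒳 ⟶ S) (k : ℕ) {U : Set (ComplexPoints S)}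
  (hU : IsCohomologicallyLocallyTrivialOn f U)

/-- **Hodge loci are cut out by holomorphic equations** (Voisin II Lemma 5.13; Cattani–Deligne–Kaplan
1995, §1: "the locus where a flat section remains of type `(p,p)` is a complex analytic subvariety";
the zero-set form of `hodgeLociDichotomy_of_holomorphicFrame`, same setting and hypotheses — `f`
cohomologically locally trivial over `U` in degree `k` with transport preserving rational classes,
Hodge structures `H_t` on the rational fibres, `W ⊆ U` a path-connected open inside the source of a
chart `ψ` into `ℂᵈ`, `x ∈ W` with an admissible state `Tx`, and a holomorphic family of bases `e t` of
`ℂ ⊗ Hᵏ(X_s; ℚ)` graded by `deg` and adapted to the transported Hodge filtrations along the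
continuations of `Tx` inside `W`). CONCLUSION: for every rational tensor `ζ ∈ T^{a,b} Hᵏ(X_s; ℚ)`,
EITHER `ζ` is a weight-`0` Hodge tensor at every point of `W` (for every continuation), OR there is a
function `g : ℂᵈ → ℂ`, holomorphic on `ψ(W)` and non-zero at `ψ t₁` for some `t₁ ∈ W`, whose zero set
`{t ∈ W | g (ψ t) = 0}` contains the locus of points of `W` at which `ζ` is a weight-`0` Hodge tensor.
(`g` is a coordinate of `1 ⊗ ζ` of negative degree in the moving tensor basis,
`analyticOnNhd_hodgeTensorBasisBC_repr`; the locus is the common zero set of all such coordinates by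
`tensorSpace_F_eq_span`, Deligne Hodge II 1.1.12.) [cite: VoisinHodgeII2003, §5.3.1 Lemma 5.13]
[cite: CattaniDeligneKaplan1995JAMS, §1] [cite: DeligneHodgeII1971, 1.1.12] -/
theorem hodgeLoci_subset_zeroSet_of_holomorphicFrame [HodgeTensorFacts.{0, 0}] (s : U)
    [Module.Finite ℚ (singularCohomology ℚ ℚ (ComplexPoints (fiberOver f s.1)) k)]
    (hrat : ∀ (x y : U) (γ : Path.Homotopic.Quotient x y) (α : complexBetti (fiberOver f x.1) k),
      IsRationalClass α → IsRationalClass (transportFun f k hU γ α))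
    {n₀ : ℤ} (H : ∀ t : U, HodgeStructure (singularCohomology ℚ ℚ (ComplexPoints (fiberOver f t.1)) k) n₀)
    {W : Set U} (hWpc : IsPathConnected W)
    {d : ℕ} (ψ : OpenPartialHomeomorph U (Fin d → ℂ)) (hWψ : W ⊆ ψ.source)
    {x : U} (hx : x ∈ W)
    {Tx : singularCohomology ℚ ℚ (ComplexPoints (fiberOver f s.1)) k ≃ₗ[ℚ]
      singularCohomology ℚ ℚ (ComplexPoints (fiberOver f x.1)) k}
    (hadm : ∃ δ : Path.Homotopic.Quotient s x,
      ∀ v, ofRatClass _ k (Tx v) = transportFun f k hU δ (ofRatClass _ k v))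
    {N : ℕ} {deg : Fin N → ℤ}
    (e : U → Module.Basis (Fin N) ℂ (ℂ ⊗[ℚ] singularCohomology ℚ ℚ (ComplexPoints (fiberOver f s.1)) k))
    (hF : ∀ t ∈ W, ∀ (ε : Path x t), (∀ r, ε r ∈ W) →
      ∀ (T : singularCohomology ℚ ℚ (ComplexPoints (fiberOver f s.1)) k ≃ₗ[ℚ]
        singularCohomology ℚ ℚ (ComplexPoints (fiberOver f t.1)) k),
      (∀ v, ofRatClass _ k (T v) = transportFun f k hU ⟦ε⟧ (ofRatClass _ k (Tx v))) →
      ∀ p : ℤ, ((H t).comapEquiv T).F p = Submodule.span ℂ (e t '' {σ | p ≤ deg σ}))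
    (hol₁ : ∀ (σ : Fin N)
      (φ : Module.Dual ℂ (ℂ ⊗[ℚ] singularCohomology ℚ ℚ (ComplexPoints (fiberOver f s.1)) k)),
      AnalyticOnNhd ℂ (fun z ↦ φ (e (ψ.symm z) σ)) (ψ '' W))
    (hol₂ : ∀ (σ : Fin N) (w : ℂ ⊗[ℚ] singularCohomology ℚ ℚ (ComplexPoints (fiberOver f s.1)) k),
      AnalyticOnNhd ℂ (fun z ↦ (e (ψ.symm z)).repr w σ) (ψ '' W))
    (a b : ℕ) (ζ : hodgeTensorSpace (singularCohomology ℚ ℚ (ComplexPoints (fiberOver f s.1)) k) a b) :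
    (∀ t ∈ W, ∀ (ε : Path x t), (∀ r, ε r ∈ W) →
      ∀ (T : singularCohomology ℚ ℚ (ComplexPoints (fiberOver f s.1)) k ≃ₗ[ℚ]
        singularCohomology ℚ ℚ (ComplexPoints (fiberOver f t.1)) k),
      (∀ v, ofRatClass _ k (T v) = transportFun f k hU ⟦ε⟧ (ofRatClass _ k (Tx v))) →
        ζ ∈ (((H t).comapEquiv T).tensorSpace a b).hodgeClasses 0) ∨
    ∃ g : (Fin d → ℂ) → ℂ, AnalyticOnNhd ℂ g (ψ '' W) ∧ (∃ t₁ ∈ W, g (ψ t₁) ≠ 0) ∧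
      {t : U | t ∈ W ∧ ∀ (ε : Path x t), (∀ r, ε r ∈ W) →
        ∀ (T : singularCohomology ℚ ℚ (ComplexPoints (fiberOver f s.1)) k ≃ₗ[ℚ]
          singularCohomology ℚ ℚ (ComplexPoints (fiberOver f t.1)) k),
        (∀ v, ofRatClass _ k (T v) = transportFun f k hU ⟦ε⟧ (ofRatClass _ k (Tx v))) →
          ζ ∈ (((H t).comapEquiv T).tensorSpace a b).hodgeClasses 0} ⊆
      {t : U | t ∈ W ∧ g (ψ t) = 0} := by
  classical
  -- the coordinate functions of `1 ⊗ ζ` in the moving tensor basis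
  obtain ⟨g, hg⟩ : ∃ g : ((Fin a → Fin N) × (Fin b → Fin N)) → U → ℂ,
      ∀ y t, g y t = (HodgeStructure.hodgeTensorBasisBC (e t) a b).repr ((1 : ℂ) ⊗ₜ[ℚ] ζ) y :=
    ⟨_, fun _ _ ↦ rfl⟩
  -- (1) membership criterion at a point of `W` with a compatible state
  have hcrit : ∀ t ∈ W, ∀ (ε : Path x t), (∀ r, ε r ∈ W) →
      ∀ (T : singularCohomology ℚ ℚ (ComplexPoints (fiberOver f s.1)) k ≃ₗ[ℚ]
        singularCohomology ℚ ℚ (ComplexPoints (fiberOver f t.1)) k),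
      (∀ v, ofRatClass _ k (T v) = transportFun f k hU ⟦ε⟧ (ofRatClass _ k (Tx v))) →
      (ζ ∈ (((H t).comapEquiv T).tensorSpace a b).hodgeClasses 0 ↔
        ∀ y, tensorDegree deg y < 0 → g y t = 0) := by
    intro t ht ε hε T hT
    rw [HodgeStructure.mem_hodgeClasses_iff,
      HodgeStructure.tensorSpace_F_eq_span _ (e t) (hF t ht ε hε T hT) a b 0,
      Module.Basis.mem_span_image]
    simp only [Set.subset_def, Finset.mem_coe, Finsupp.mem_support_iff, Set.mem_setOf_eq, hg,
      HodgeStructure.ofRat_apply]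
    constructor
    · intro h y hy
      by_contra hne
      exact absurd (h y hne) (not_le.2 hy)
    · intro h y hne
      by_contra hlt
      exact hne (h y (not_le.1 hlt))
  -- (2) compatible states exist at every point of `W`
  have hex : ∀ t ∈ W, ∃ (ε : Path x t), (∀ r, ε r ∈ W) ∧
      ∃ T : singularCohomology ℚ ℚ (ComplexPoints (fiberOver f s.1)) k ≃ₗ[ℚ]
        singularCohomology ℚ ℚ (ComplexPoints (fiberOver f t.1)) k,
      ∀ v, ofRatClass _ k (T v) = transportFun f k hU ⟦ε⟧ (ofRatClass _ k (Tx v)) := by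
    intro t ht
    have hj : JoinedIn W x t := hWpc.joinedIn x hx t ht
    obtain ⟨δ, hδ⟩ := hadm
    obtain ⟨T, hT⟩ := exists_ratTransport f k hU hrat (δ.trans ⟦hj.somePath⟧)
    exact ⟨hj.somePath, hj.somePath_mem, T, fun v ↦ by rw [hT, transportFun_trans, hδ]⟩
  -- (3) on `W` the locus is the common zero set of the coordinates of negative degree
  have hZ : ∀ t ∈ W, ((∀ (ε : Path x t), (∀ r, ε r ∈ W) →
      ∀ (T : singularCohomology ℚ ℚ (ComplexPoints (fiberOver f s.1)) k ≃ₗ[ℚ]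
        singularCohomology ℚ ℚ (ComplexPoints (fiberOver f t.1)) k),
      (∀ v, ofRatClass _ k (T v) = transportFun f k hU ⟦ε⟧ (ofRatClass _ k (Tx v))) →
        ζ ∈ (((H t).comapEquiv T).tensorSpace a b).hodgeClasses 0) ↔
      ∀ y, tensorDegree deg y < 0 → g y t = 0) := by
    intro t ht
    constructor
    · intro h
      obtain ⟨ε, hε, T, hT⟩ := hex t ht
      exact (hcrit t ht ε hε T hT).1 (h ε hε T hT)
    · intro h ε hε T hT
      exact (hcrit t ht ε hε T hT).2 h
  -- (4) the coordinates are holomorphic in the chart, hence continuous on `W`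
  have hga : ∀ y, AnalyticOnNhd ℂ (fun z ↦ g y (ψ.symm z)) (ψ '' W) := by
    intro y
    simp only [hg]
    exact analyticOnNhd_hodgeTensorBasisBC_repr e ψ.symm hol₁ hol₂ a b ζ y
  -- (5) the alternative: everything, or a non-trivial holomorphic equation
  by_cases hfull : ∀ t ∈ W, ∀ y, tensorDegree deg y < 0 → g y t = 0
  · exact Or.inl fun t ht ε hε T hT ↦ (hcrit t ht ε hε T hT).2 (hfull t ht)
  · right
    push Not at hfull
    obtain ⟨t₁, ht₁, y₁, hy₁, hne⟩ := hfull
    refine ⟨fun z ↦ g y₁ (ψ.symm z), hga y₁, ⟨t₁, ht₁, ?_⟩, fun t ht ↦ ⟨ht.1, ?_⟩⟩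
    · change g y₁ (ψ.symm (ψ t₁)) ≠ 0
      rwa [ψ.left_inv (hWψ ht₁)]
    · change g y₁ (ψ.symm (ψ t)) = 0
      rw [ψ.left_inv (hWψ ht.1)]
      exact (hZ t ht.1).1 ht.2 y₁ hy₁

end ZeroSet

end HodgeTheory

end Literature.AlgebraicGeometry.HodgeTheory

end
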